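import Summits.AnomalousDissipation.AnomalousDissipation.Theorems.SolenoidalFractalHomogenisationLagrangianStepCellChainClassical
import Literature.Analysis.ODE.LinearPeriodicAveraging
import Mathlib.Analysis.SpecialFunctions.Exponential
import HarnessLib

/-!
# K1L_D `LagrangianRenormalisationStepDesign` (stmt-AnomalousDissipation-27980), `stub_cellLawV0_IS` V0:
# VARIATION OF CONSTANTS (Duhamel) for the modes of a weak solution of the flat tensor cell problem against the frozen modal flow
# `exp(−t·L_k)`, `L_k = 4π² P_k T_{𝔹ᵀ}(k)` (helper; `--supports stmt-AnomalousDissipation-27980`)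

Summits-side helper file of route `SolenoidalFractalHomogenisation` (prover seat `ad-k1l-cellLawV-w1` g5).  Everything proved; no definitions,
no named facts, no sorry.

* §1 (generic, real Banach space `E`, `G : E →L[ℝ] E`) `eq_exp_add_integral_of_hasDerivAt` — if `x` is continuous on `[t₀,t₁]` with
  `x' = −G x + f` on `(t₀,t₁)` for a forcing `f` continuous on `[t₀,t₁]`, then
  `x t₁ = exp(−(t₁−t₀)G) x t₀ + ∫_{t₀}^{t₁} exp(−(t₁−s)G) f(s) ds` (fundamental theorem of calculus for `s ↦ exp(−(t₁−s)G) x(s)`);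
  `norm_le_exp_add_integral_of_hasDerivAt` — with `G` coercive (`r·‖v‖² ≤ ⟪Gv,v⟫`, real inner-product space) the contraction
  `‖exp(−τG)‖ ≤ e^{−rτ}` (`Literature.Analysis.ODE.PeriodicAveraging.norm_exp_neg_smul_apply_le`) gives
  `‖x t₁‖ ≤ e^{−r(t₁−t₀)}‖x t₀‖ + ∫_{t₀}^{t₁} e^{−r(t₁−s)}‖f s‖ ds`.
* §2 (the cell chain) **`modeRep_eq_exp_add_integral`** — for THE weak solution `h : Torus.IsWeakTensorPassiveVectorOn 0 T 𝔹 (W₁.cell n) F u`,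
  every mode `k` and every window `[t₀,t₁] ⊆ [0,T]`:
  `modeRep k t₁ = exp(−(t₁−t₀)·L_k) (modeRep k t₀) − ∫_{t₀}^{t₁} exp(−(t₁−s)·L_k) (Σⱼ linkCoeffⱼ(k,s) • P_k(aⱼ modeRep(k−Kⱼ,s) + a′ⱼ modeRep(k+Kⱼ,s))) ds`
  with `L_k := (Torus.modalAdjGen (majorTranspose 𝔹) k).restrictScalars ℝ` (the chain is classical on `(0,T)` by `…CellChainClassical`, the
  representatives are continuous on `[0,T]`): the slow mode against its frozen decay with the two-neighbour link forcing (the starting point of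
  the Markov / quasi-static reduction of the slow equation), and every sideband against its own damping.
NOT a proof of any registered stub, of the crux, or of anomalous dissipation; rung F-D1.A0 infrastructure.
-/

set_option linter.dupNamespace false

noncomputable section

namespace Summit.AnomalousDissipation.AnomalousDissipation.Theorems.SolenoidalFractalHomogenisation.LagrangianStep.CellChain

open Set MeasureTheory Filter Topology Function Complex UnitAddTorus NormedSpace intervalIntegral
open scoped InnerProductSpace ComplexConjugate
open Literature.Analysis Literature.Analysis.FunctionSpaces Literature.Analysis.FunctionSpaces.Torus
open Literature.Analysis.FluidPDE Literature.Analysis.FluidPDE.Torus Literature.Analysis.FluidPDE.LatticeShear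

/-! ## §1 Variation of constants with a continuous forcing (generic) -/

section Generic

variable {E : Type*} [NormedAddCommGroup E] [NormedSpace ℝ E] [CompleteSpace E]

/-- `d/ds exp(−(t−s)G) = exp(−(t−s)G)·G`. [folklore] -/
theorem hasDerivAt_exp_neg_sub_smul' (G : E →L[ℝ] E) (t s : ℝ) :
    HasDerivAt (fun u : ℝ => exp (-((t - u) • G))) (exp (-((t - s) • G)) * G) s := by
  have h1 : HasDerivAt (fun u : ℝ => exp (u • (-G))) (exp ((t - s) • (-G)) * (-G)) (t - s) := hasDerivAt_exp_smul_const (-G) (t - s)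
  have h2 := h1.scomp s ((hasDerivAt_id s).const_sub t)
  simp only [Function.comp_def, smul_neg, mul_neg, neg_smul, one_smul, neg_neg] at h2
  exact h2

/-- **Variation of constants (Duhamel) with a continuous forcing.**  If `x` is continuous on `[t₀,t₁]` and `x' = −G x + f` on `(t₀,t₁)` with
`f` continuous on `[t₀,t₁]`, then `x t₁ = exp(−(t₁−t₀)G) x t₀ + ∫_{t₀}^{t₁} exp(−(t₁−s)G) f s ds`.
[cite: Hale1980, Ch. III §1, Theorem 1.1 (variation of constants formula)] -/
theorem eq_exp_add_integral_of_hasDerivAt (G : E →L[ℝ] E) {x f : ℝ → E} {t₀ t₁ : ℝ} (ht : t₀ ≤ t₁)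
    (hxc : ContinuousOn x (Icc t₀ t₁)) (hfc : ContinuousOn f (Icc t₀ t₁))
    (hx : ∀ s ∈ Ioo t₀ t₁, HasDerivAt x (-(G (x s)) + f s) s) :
    x t₁ = exp (-((t₁ - t₀) • G)) (x t₀) + ∫ s in t₀..t₁, exp (-((t₁ - s) • G)) (f s) := by
  set Φ : ℝ → E := fun s => exp (-((t₁ - s) • G)) (x s) with hΦ
  have hEc : Continuous fun s : ℝ => exp (-((t₁ - s) • G)) :=
    continuous_iff_continuousAt.2 fun s => (hasDerivAt_exp_neg_sub_smul' G t₁ s).continuousAt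
  have hΦc : ContinuousOn Φ (Icc t₀ t₁) := hEc.continuousOn.clm_apply hxc
  have hΦd : ∀ s ∈ Ioo t₀ t₁, HasDerivAt Φ (exp (-((t₁ - s) • G)) (f s)) s := by
    intro s hs
    have h := (hasDerivAt_exp_neg_sub_smul' G t₁ s).clm_apply (hx s hs)
    have h0 : (exp (-((t₁ - s) • G)) * G) (x s) + (exp (-((t₁ - s) • G))) (-(G (x s)) + f s) = exp (-((t₁ - s) • G)) (f s) := by
      rw [mul_apply_eq_comp, map_add, map_neg]; abel
    rw [h0] at h
    exact h
  have hic : ContinuousOn (fun s => exp (-((t₁ - s) • G)) (f s)) (Icc t₀ t₁) := hEc.continuousOn.clm_apply hfc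
  have hint := integral_eq_sub_of_hasDerivAt_of_le ht hΦc hΦd (hic.intervalIntegrable_of_Icc ht)
  have hΦ1 : Φ t₁ = x t₁ := by simp [hΦ]
  have hΦ0 : Φ t₀ = exp (-((t₁ - t₀) • G)) (x t₀) := by simp [hΦ]
  rw [hΦ1, hΦ0] at hint
  rw [hint]; abel

end Generic

section Coercive

variable {E : Type*} [NormedAddCommGroup E] [InnerProductSpace ℝ E] [CompleteSpace E]

/-- **Duhamel bound under coercivity.**  In the situation of `eq_exp_add_integral_of_hasDerivAt`, if `r·‖v‖² ≤ ⟪G v, v⟫` for all `v`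
then `‖x t₁‖ ≤ e^{−r(t₁−t₀)}‖x t₀‖ + ∫_{t₀}^{t₁} e^{−r(t₁−s)}‖f s‖ ds`.
[cite: Hale1980, Ch. III §1, Theorem 1.1] [cite: SandersVerhulstMurdock2007, Lemma 5.2.7 (linear case)] -/
theorem norm_le_exp_add_integral_of_hasDerivAt (G : E →L[ℝ] E) {r : ℝ} (hG : ∀ v, r * ‖v‖ ^ 2 ≤ ⟪G v, v⟫_ℝ)
    {x f : ℝ → E} {t₀ t₁ : ℝ} (ht : t₀ ≤ t₁)
    (hxc : ContinuousOn x (Icc t₀ t₁)) (hfc : ContinuousOn f (Icc t₀ t₁))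
    (hx : ∀ s ∈ Ioo t₀ t₁, HasDerivAt x (-(G (x s)) + f s) s) :
    ‖x t₁‖ ≤ Real.exp (-(r * (t₁ - t₀))) * ‖x t₀‖ + ∫ s in t₀..t₁, Real.exp (-(r * (t₁ - s))) * ‖f s‖ := by
  rw [eq_exp_add_integral_of_hasDerivAt G ht hxc hfc hx]
  have hEc : Continuous fun s : ℝ => exp (-((t₁ - s) • G)) :=
    continuous_iff_continuousAt.2 fun s => (hasDerivAt_exp_neg_sub_smul' G t₁ s).continuousAt
  have h1 : ‖exp (-((t₁ - t₀) • G)) (x t₀)‖ ≤ Real.exp (-(r * (t₁ - t₀))) * ‖x t₀‖ :=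
    Literature.Analysis.ODE.PeriodicAveraging.norm_exp_neg_smul_apply_le G hG (x t₀) (by linarith)
  have h2 : ‖∫ s in t₀..t₁, exp (-((t₁ - s) • G)) (f s)‖ ≤ ∫ s in t₀..t₁, Real.exp (-(r * (t₁ - s))) * ‖f s‖ := by
    refine intervalIntegral.norm_integral_le_of_norm_le ht ?_ ?_
    · exact Filter.Eventually.of_forall fun s hs =>
        Literature.Analysis.ODE.PeriodicAveraging.norm_exp_neg_smul_apply_le G hG (f s) (by linarith [hs.2])
    · exact ((Real.continuous_exp.comp (continuous_const.mul (continuous_const.sub continuous_id)).neg).continuousOn.mul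
        hfc.norm).intervalIntegrable_of_Icc ht
  exact (norm_add_le _ _).trans (add_le_add h1 h2)

end Coercive

/-! ## §2 The cell chain: every mode against its frozen modal flow -/

variable {k₀ : ℕ}

/-- **Duhamel for the modes of THE weak solution.**  For every mode `k` and window `[t₀,t₁] ⊆ [0,T]`:
`modeRep k t₁ = exp(−(t₁−t₀)·L_k)(modeRep k t₀) + ∫_{t₀}^{t₁} exp(−(t₁−s)·L_k)(−Σⱼ linkCoeffⱼ(k,s) • P_k(aⱼ modeRep(k−Kⱼ,s) + a′ⱼ modeRep(k+Kⱼ,s))) ds`,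
`L_k = (modalAdjGen (majorTranspose 𝔹) k).restrictScalars ℝ`. [cite: Hale1980, Ch. III §1, Theorem 1.1] [cite: MeshalkinSinai1961, pp. 1700–1705] -/
theorem modeRep_eq_exp_add_integral (W₁ : LatticeWord k₀) (n : ℕ) {T : ℝ} {𝔹 : Torus.Visc4 (Fin 3)}
    {F : UnitAddTorus (Fin 3) → EuclideanSpace ℝ (Fin 3)} {u : ℝ → UnitAddTorus (Fin 3) → EuclideanSpace ℝ (Fin 3)}
    (h : Torus.IsWeakTensorPassiveVectorOn 0 T 𝔹 (W₁.cell n) F u) (hF : Integrable F volume) (k : Fin 3 → ℤ)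
    {t₀ t₁ : ℝ} (h0 : 0 ≤ t₀) (h01 : t₀ ≤ t₁) (h1 : t₁ ≤ T) :
    modeRep W₁ n 𝔹 F u k t₁ =
      exp (-((t₁ - t₀) • (Torus.modalAdjGen (Torus.majorTranspose 𝔹) k).restrictScalars ℝ)) (modeRep W₁ n 𝔹 F u k t₀) +
      ∫ s in t₀..t₁, exp (-((t₁ - s) • (Torus.modalAdjGen (Torus.majorTranspose 𝔹) k).restrictScalars ℝ))
        (-(∑ j, linkCoeff W₁ n k j s • transversalProj k
          ((Complex.exp ((W₁.phase j).φ * Complex.I) * (1 / (2 * ((2 * Real.pi * ‖latticeVec (W₁.phase j).m‖ : ℝ) : ℂ) * Complex.I))) •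
              modeRep W₁ n 𝔹 F u (k - fun i => (W₁.phase j).m i * n) s +
            (starRingEnd ℂ (Complex.exp ((W₁.phase j).φ * Complex.I)) *
                (-(1 / (2 * ((2 * Real.pi * ‖latticeVec (W₁.phase j).m‖ : ℝ) : ℂ) * Complex.I)))) •
              modeRep W₁ n 𝔹 F u (k + fun i => (W₁.phase j).m i * n) s))) := by
  have hT : 0 ≤ T := h0.trans (h01.trans h1)
  have hsub : Icc t₀ t₁ ⊆ Icc 0 T := Icc_subset_Icc h0 h1
  have hxc : ContinuousOn (modeRep W₁ n 𝔹 F u k) (Icc t₀ t₁) := (continuousOn_modeRep W₁ n hT h k).mono hsub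
  -- the forcing is continuous on `[0,T]` (representatives continuous, link coefficients continuous)
  have hrep : ∀ k', ContinuousOn (modeRep W₁ n 𝔹 F u k') (Icc 0 T) := fun k' => continuousOn_modeRep W₁ n hT h k'
  have h4 : ∀ j : Fin k₀, ContinuousOn (fun t => linkCoeff W₁ n k j t • transversalProj k
          ((Complex.exp ((W₁.phase j).φ * Complex.I) * (1 / (2 * ((2 * Real.pi * ‖latticeVec (W₁.phase j).m‖ : ℝ) : ℂ) * Complex.I))) •
              modeRep W₁ n 𝔹 F u (k - fun i => (W₁.phase j).m i * n) t +
            (starRingEnd ℂ (Complex.exp ((W₁.phase j).φ * Complex.I)) *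
                (-(1 / (2 * ((2 * Real.pi * ‖latticeVec (W₁.phase j).m‖ : ℝ) : ℂ) * Complex.I)))) •
              modeRep W₁ n 𝔹 F u (k + fun i => (W₁.phase j).m i * n) t)) (Icc 0 T) := by
    intro j
    have ha : ContinuousOn (fun t =>
        (Complex.exp ((W₁.phase j).φ * Complex.I) * (1 / (2 * ((2 * Real.pi * ‖latticeVec (W₁.phase j).m‖ : ℝ) : ℂ) * Complex.I))) •
              modeRep W₁ n 𝔹 F u (k - fun i => (W₁.phase j).m i * n) t +
            (starRingEnd ℂ (Complex.exp ((W₁.phase j).φ * Complex.I)) *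
                (-(1 / (2 * ((2 * Real.pi * ‖latticeVec (W₁.phase j).m‖ : ℝ) : ℂ) * Complex.I)))) •
              modeRep W₁ n 𝔹 F u (k + fun i => (W₁.phase j).m i * n) t) (Icc 0 T) :=
      ((hrep (k - fun i => (W₁.phase j).m i * n)).const_smul
        (Complex.exp ((W₁.phase j).φ * Complex.I) * (1 / (2 * ((2 * Real.pi * ‖latticeVec (W₁.phase j).m‖ : ℝ) : ℂ) * Complex.I)))).add
        ((hrep (k + fun i => (W₁.phase j).m i * n)).const_smul
          (starRingEnd ℂ (Complex.exp ((W₁.phase j).φ * Complex.I)) *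
                (-(1 / (2 * ((2 * Real.pi * ‖latticeVec (W₁.phase j).m‖ : ℝ) : ℂ) * Complex.I)))))
    have hb : ContinuousOn (fun t => transversalProj k
        ((Complex.exp ((W₁.phase j).φ * Complex.I) * (1 / (2 * ((2 * Real.pi * ‖latticeVec (W₁.phase j).m‖ : ℝ) : ℂ) * Complex.I))) •
              modeRep W₁ n 𝔹 F u (k - fun i => (W₁.phase j).m i * n) t +
            (starRingEnd ℂ (Complex.exp ((W₁.phase j).φ * Complex.I)) *
                (-(1 / (2 * ((2 * Real.pi * ‖latticeVec (W₁.phase j).m‖ : ℝ) : ℂ) * Complex.I)))) •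
              modeRep W₁ n 𝔹 F u (k + fun i => (W₁.phase j).m i * n) t)) (Icc 0 T) :=
      ((transversalProj k).continuous.comp_continuousOn ha).congr fun t _ => rfl
    exact (continuous_linkCoeff W₁ n k j).continuousOn.smul hb
  have hfc := ((continuousOn_finsetSum (Finset.univ : Finset (Fin k₀)) fun j _ => h4 j).neg).mono hsub
  refine eq_exp_add_integral_of_hasDerivAt _ h01 hxc hfc fun s hs => ?_
  have hs' : s ∈ Ioo 0 T := ⟨lt_of_le_of_lt h0 hs.1, lt_of_lt_of_le hs.2 h1⟩
  have hd := hasDerivAt_modeRep W₁ n h hF k hs'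
  refine hd.congr_deriv ?_
  rw [ContinuousLinearMap.coe_restrictScalars', Torus.modalAdjGen_apply]
  abel

end Summit.AnomalousDissipation.AnomalousDissipation.Theorems.SolenoidalFractalHomogenisation.LagrangianStep.CellChain

end
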